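import Mathlib
import Summits.NavierStokesRegularity.NavierStokesRegularity.Theorems.EulerZoomLiouvillePowerGaugeEulerLiouvilleSelfSimilarEndpointRieszScaleConsistency
import HarnessLib

/-!
# Rung C1 of the crux `EulerZoomLiouville.PowerGaugeEulerLiouville`: a global representative
# of the scale-wise Riesz pressures `Q_R` of an `L² ∩ L³_loc` field

Route №10 `EulerZoomLiouville` (NavierStokesRegularity), crux E = stmt-NavierStokesRegularity-19832,
rung C1 at the endpoint.  For `V ∈ L² ∩ L³_loc` (no global `L³`, so no whole-space Riesz
pressure) the scale-wise pressures `Q_R = Π[V·1_{B_R}] + ∫_{|z| ≥ R} K(·−z)(V z) dz` are consistent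
(`scaleQ_ae_eq_of_le`); patching them along the dyadic-free countable family `R_k = 4(k+1)`,
`k = ⌈|y|⌉`, gives ONE locally integrable function `Q` on `ℝ³` with `Q = Q_R` a.e. on `B_{R/2}`
for every `R > 0`:

* `integrableOn_scaleQ_ball` — `Q_R ∈ L¹(B_{R/2})`;
* `exists_global_scaleQ` — the global representative.

`Q` is the substitute for `−Δ⁻¹∂ᵢ∂ⱼ(VᵢVⱼ)`; the identification `P = Q` of a pressure profile
solving the weak Poisson equation is the sequel (`…PressureIdentification`).

WHAT THIS IS NOT: not NS, not E, not rung C1 — harmonic-analysis plumbing.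
-/

noncomputable section

-- flat `Theorems/<Route><Decl>…` files of one crux share the namespace of the crux (tree convention)
set_option linter.dupNamespace false

open MeasureTheory Set Filter Topology Metric Function TopologicalSpace
open scoped ENNReal NNReal InnerProductSpace RealInnerProductSpace Laplacian

namespace Summit.NavierStokesRegularity.NavierStokesRegularity.Theorems.PowerGaugeEulerLiouville

open Literature.Analysis Literature.Analysis.FunctionSpaces Literature.Analysis.FluidPDE

variable {V : EuclideanSpace ℝ (Fin 3) → EuclideanSpace ℝ (Fin 3)}

section Global

/-- **`Q_R` is integrable on `B_{R/2}`:** the Riesz pressure of `V·1_{B_R} ∈ L³` is in `L^{3/2}`,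
hence locally integrable, and the far integral is a.e.-measurable and bounded by
`8‖V‖₂²/(2π R³)` there. [folklore] -/
theorem integrableOn_scaleQ_ball (hVm : AEStronglyMeasurable V volume)
    (hV2 : Integrable (fun z => ‖V z‖ ^ 2) volume)
    (hV3 : LocallyIntegrable (fun y => ‖V y‖ ^ 3) volume) {R : ℝ} (hR : 0 < R) :
    IntegrableOn (fun y => rieszPressure ((ball (0 : EuclideanSpace ℝ (Fin 3)) R).indicator V) y +
        ∫ z in {z | R ≤ ‖z‖}, pressureKernel (y - z) (V z))
      (ball (0 : EuclideanSpace ℝ (Fin 3)) (R / 2)) volume := by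
  have h3 : MemLp ((ball (0 : EuclideanSpace ℝ (Fin 3)) R).indicator V) 3 volume :=
    memLp_indicator_three_of_subset hVm hV3 measurableSet_ball ball_subset_closedBall
  have h32 : (1 : ℝ≥0∞) ≤ 3 / 2 := by
    rw [ENNReal.le_div_iff_mul_le (Or.inl two_ne_zero) (Or.inl ENNReal.ofNat_ne_top)]; norm_num
  have hQ1 : IntegrableOn (fun y => rieszPressure ((ball (0 : EuclideanSpace ℝ (Fin 3)) R).indicator V) y)
      (ball (0 : EuclideanSpace ℝ (Fin 3)) (R / 2)) volume :=
    (((memLp_rieszPressure h3).locallyIntegrable h32).integrableOn_isCompact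
      (isCompact_closedBall 0 (R / 2))).mono_set ball_subset_closedBall
  have hFar : IntegrableOn (fun y => ∫ z in {z | R ≤ ‖z‖}, pressureKernel (y - z) (V z))
      (ball (0 : EuclideanSpace ℝ (Fin 3)) (R / 2)) volume := by
    refine Measure.integrableOn_of_bounded measure_ball_lt_top.ne
      (aestronglyMeasurable_farIntegral hVm _) (M := 8 * (∫ z, ‖V z‖ ^ 2) / (2 * Real.pi * R ^ 3)) ?_
    rw [ae_restrict_iff' measurableSet_ball]
    refine Eventually.of_forall fun y hy => ?_
    rw [Real.norm_eq_abs]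
    rw [mem_ball, dist_zero_right] at hy
    exact abs_setIntegral_pressureKernel_far_le hV2 hR hy.le
  exact hQ1.add hFar

/-- **A global representative of the scale-wise Riesz pressures.**  For `V ∈ L² ∩ L³_loc` there
is a locally integrable `Q : ℝ³ → ℝ` with `Q = Π[V·1_{B_R}] + ∫_{|z| ≥ R} K(·−z)(V z) dz` a.e.
on `B_{R/2}`, for every `R > 0` (take `Q(y) = Q_{4(⌈|y|⌉+1)}(y)` and use the consistency
`scaleQ_ae_eq_of_le` along the countably many scales `4(k+1)`). [folklore] -/
theorem exists_global_scaleQ (hVm : AEStronglyMeasurable V volume)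
    (hV2 : Integrable (fun z => ‖V z‖ ^ 2) volume)
    (hV3 : LocallyIntegrable (fun y => ‖V y‖ ^ 3) volume) :
    ∃ Q : EuclideanSpace ℝ (Fin 3) → ℝ, LocallyIntegrable Q volume ∧
      ∀ R : ℝ, 0 < R → ∀ᵐ y ∂volume, ‖y‖ < R / 2 →
        Q y = rieszPressure ((ball (0 : EuclideanSpace ℝ (Fin 3)) R).indicator V) y +
          ∫ z in {z | R ≤ ‖z‖}, pressureKernel (y - z) (V z) := by
  set QR : ℝ → EuclideanSpace ℝ (Fin 3) → ℝ := fun r y =>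
    rieszPressure ((ball (0 : EuclideanSpace ℝ (Fin 3)) r).indicator V) y +
      ∫ z in {z | r ≤ ‖z‖}, pressureKernel (y - z) (V z) with hQR
  set Q : EuclideanSpace ℝ (Fin 3) → ℝ := fun y => QR (4 * ((⌈‖y‖⌉₊ : ℝ) + 1)) y with hQ
  -- consistency between two arbitrary positive scales, on the smaller inner ball
  have hcons : ∀ r r' : ℝ, 0 < r → 0 < r' →
      ∀ᵐ y ∂volume, ‖y‖ < min r r' / 2 → QR r y = QR r' y := by
    intro r r' hr hr'
    rcases le_total r r' with h | h
    · filter_upwards [scaleQ_ae_eq_of_le hVm hV2 hV3 hr h] with y hy hymin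
      rw [min_eq_left h] at hymin
      exact hy hymin
    · filter_upwards [scaleQ_ae_eq_of_le hVm hV2 hV3 hr' h] with y hy hymin
      rw [min_eq_right h] at hymin
      exact (hy hymin).symm
  -- `Q = Q_R` a.e. on `B_{R/2}`
  have hQR' : ∀ R : ℝ, 0 < R → ∀ᵐ y ∂volume, ‖y‖ < R / 2 → Q y = QR R y := by
    intro R hR
    have hall : ∀ k : ℕ, ∀ᵐ y ∂volume, ‖y‖ < min R (4 * ((k : ℝ) + 1)) / 2 →
        QR R y = QR (4 * ((k : ℝ) + 1)) y :=
      fun k => hcons R _ hR (by positivity)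
    rw [← ae_all_iff] at hall
    filter_upwards [hall] with y hy hyR
    set k : ℕ := ⌈‖y‖⌉₊ with hk
    have hyk : ‖y‖ ≤ (k : ℝ) := Nat.le_ceil _
    have hmin : ‖y‖ < min R (4 * ((k : ℝ) + 1)) / 2 := by
      rw [lt_div_iff₀ two_pos, lt_min_iff]
      constructor <;> linarith
    rw [hQ]
    exact (hy k hmin).symm
  refine ⟨Q, ?_, fun R hR => hQR' R hR⟩
  -- local integrability
  rw [locallyIntegrable_iff]
  intro K hK
  obtain ⟨n₀, hKn⟩ := hK.isBounded.subset_closedBall (0 : EuclideanSpace ℝ (Fin 3))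
  set R : ℝ := 2 * (|n₀| + 1) with hRdef
  have hR : 0 < R := by positivity
  have hKb : K ⊆ ball (0 : EuclideanSpace ℝ (Fin 3)) (R / 2) :=
    hKn.trans (closedBall_subset_ball (by rw [hRdef]; linarith [le_abs_self n₀]))
  refine IntegrableOn.mono_set ?_ hKb
  refine (integrableOn_scaleQ_ball hVm hV2 hV3 hR).congr_fun_ae ?_
  rw [EventuallyEq, ae_restrict_iff' measurableSet_ball]
  filter_upwards [hQR' R hR] with y hy hyb
  rw [mem_ball, dist_zero_right] at hyb
  exact (hy hyb).symm

end Global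

end Summit.NavierStokesRegularity.NavierStokesRegularity.Theorems.PowerGaugeEulerLiouville
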